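import Summits.ResolutionOfSingularities.ResolutionOfSingularities.Theorems.HilbertSamuelEliminationSigmaMaxModificationsCorridor3HypersurfacePoints
import Literature.RingTheory.HilbertSamuel.Quotient
import Literature.AlgebraicGeometry.Resolution.AdicCompletionRegular
import Literature.AlgebraicGeometry.Resolution.SubschemeRegularStalks
import Literature.AlgebraicGeometry.Resolution.RegularLocalRingsQuotient
import Literature.AlgebraicGeometry.Resolution.RegularLocalHeights
import Mathlib.RingTheory.RegularLocalRing.Polynomial
import Mathlib.RingTheory.KrullDimension.Regular
import HarnessLib

/-!
# [OURS · L1 W4.2] Bricks for C4 P1 `AlgIsolatedOfIsolated` (W4.2 DEAL D15 «P1 PROOF»; crux `SigmaMaxModifications`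
# stmt-ResolutionOfSingularities-18506, conjunct `SigmaMaxModificationsCorridor3` stmt-…-19249; `--supports stmt-…-19249`, helper)
# — part 3: the HYPERSURFACE `S[X]/(h)` localised at a prime: Hilbert function `hypersurfaceHFe` and dimension drop

OURS (cell res-hironaka, slot W4.2, seat res-D-pv-042 AS W4.2 DEAL hand D15); NOT statements of H. Hironaka's manuscript
[Hironaka2017] nor of [CossartJannsenSaito2020]. AI-drafted, weaker than expert review. Sorry-free PROOF file (no new definition),
fact-free.

For a regular local ring `S`, `B = S[X]`, `h ∈ B` and a prime `Q` of `R = B/(h)` over `p = Q ∩ B ⊇ (h)`: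
* `ringEquiv_localization_quotient` — `B_p/(h) ≅ R_Q` (localisation commutes with quotients, Mathlib `IsLocalization.algEquiv`);
* `not_mem_comap_pow_succ_of_map_monic` — **`h ∉ p^{(m+1)}`** when a coefficient reduction `ρ : S[X] → D[X]` over a DOMAIN `D` with
  `ρ(p) ⊆ (X)` and `p = ρ⁻¹(X)` sends `h` to a monic polynomial of degree `m` (`X^{m+1} ∤ ρ(s)ρ(h)` for `s ∉ p`);
* `hilbertFun_localization_atPrime_quotient` — with `h ∈ p^m ∖ p^{(m+1)}`: **`H^{(0)}[R_Q] = hypersurfaceHFe (edim B_p) m` and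
  `dim R_Q + 1 = dim B_p`** (`B_p` is regular local: Serre `isRegularRing_of_isRegularLocalRing` + Mathlib
  `Polynomial.isRegularRing_of_isRegularRing`; tree `hilbertFun_quotient_span_singleton`).

## References

* V. Cossart, U. Jannsen, S. Saito, LNM 2270 (2020): Thm. 2.3, §2.2. [CossartJannsenSaito2020]
* H. Matsumura, *Commutative Ring Theory* (1986), Thm. 14.2, Thm. 17.10, Thm. 19.3 / 19.5. [Matsumura1987]
-/

noncomputable section

set_option linter.dupNamespace false -- mandated namespace of this single-conjunct summit

open IsLocalRing Polynomial
open Literature.AlgebraicGeometry.Resolution Literature.RingTheory.HilbertSamuel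
open Summit.ResolutionOfSingularities.ResolutionOfSingularities.Theorems.SigmaMaxModificationsCorridor3.Helpers

universe u

namespace Summit.ResolutionOfSingularities.ResolutionOfSingularities.Cruxes.SigmaMaxModifications.IdeasL1C4

variable {S : Type u} [CommRing S]

/-! ## Localisation commutes with the quotient by `(h)` -/

/-- **`B_p/(h) ≅ (B/(h))_Q`** for a prime `Q` of `B/(h)` and `p = Q ∩ B` (any commutative ring `B`, any ideal `I` in place
of `(h)`). [folklore] -/
theorem exists_ringEquiv_localization_quotient {B : Type u} [CommRing B] (I : Ideal B) (Q : Ideal (B ⧸ I)) [Q.IsPrime]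
    (p : Ideal B) [p.IsPrime] (hp : p = Q.comap (Ideal.Quotient.mk I)) :
    Nonempty (Localization.AtPrime p ⧸ I.map (algebraMap B (Localization.AtPrime p)) ≃+* Localization.AtPrime Q) := by
  have hmem : ∀ c : B, Ideal.Quotient.mk I c ∈ Q ↔ c ∈ p := fun c => by rw [hp, Ideal.mem_comap]
  have hM : Algebra.algebraMapSubmonoid (B ⧸ I) p.primeCompl = Q.primeCompl := by
    ext b
    constructor
    · rintro ⟨c, hc, rfl⟩
      exact fun h => hc ((hmem c).mp h)
    · intro hb
      obtain ⟨c, rfl⟩ := Ideal.Quotient.mk_surjective b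
      exact ⟨c, fun h => hb ((hmem c).mpr h), rfl⟩
  haveI : IsLocalization.AtPrime (Localization.AtPrime p ⧸ I.map (algebraMap B (Localization.AtPrime p))) Q := by
    have := (inferInstance : IsLocalization (Algebra.algebraMapSubmonoid (B ⧸ I) p.primeCompl)
      (Localization.AtPrime p ⧸ I.map (algebraMap B (Localization.AtPrime p))))
    rwa [hM] at this
  exact ⟨(IsLocalization.algEquiv Q.primeCompl
    (Localization.AtPrime p ⧸ I.map (algebraMap B (Localization.AtPrime p))) (Localization.AtPrime Q)).toRingEquiv⟩

/-! ## `h ∉ p^{(m+1)}` by reduction of coefficients to a domain -/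

/-- **No extra order along `p`**: let `σ : S → D` be a ring map to a DOMAIN, `ρ = σ[X] : S[X] → D[X]`, and `p` the prime
`ρ⁻¹((X))`. If `ρ(h)` is monic of degree `m`, then `h ∉ p^{(m+1)} = (p^{m+1} B_p) ∩ B`: for `s ∉ p`, `ρ(s)` is prime to `X`, so
`X^{m+1} ∣ ρ(s h)` would force `X^{m+1} ∣ ρ(h)`, of degree `m`. [folklore] -/
theorem not_mem_comap_pow_succ_of_map_monic {D : Type u} [CommRing D] [IsDomain D] (σ : S →+* D) (h : S[X])
    {m : ℕ} (hmon : (h.map σ).Monic) (hdeg : (h.map σ).natDegree = m) (p : Ideal S[X]) [p.IsPrime]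
    (hp : p = (Ideal.span {(X : D[X])}).comap (mapRingHom σ)) :
    h ∉ ((maximalIdeal (Localization.AtPrime p)) ^ (m + 1)).comap (algebraMap S[X] (Localization.AtPrime p)) := by
  intro hmem
  rw [Ideal.mem_comap, ← Localization.AtPrime.map_eq_maximalIdeal, ← Ideal.map_pow,
    IsLocalization.algebraMap_mem_map_algebraMap_iff p.primeCompl] at hmem
  obtain ⟨s, hs, hsh⟩ := hmem
  -- apply `ρ`: `ρ(p^{m+1}) ⊆ (X^{m+1})`
  have hρ : (mapRingHom σ) (s * h) ∈ Ideal.span {(X : D[X])} ^ (m + 1) := by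
    have h1 : (p ^ (m + 1)).map (mapRingHom σ) ≤ Ideal.span {(X : D[X])} ^ (m + 1) := by
      rw [Ideal.map_pow, hp]
      exact Ideal.pow_right_mono Ideal.map_comap_le _
    exact h1 (Ideal.mem_map_of_mem _ hsh)
  rw [Ideal.span_singleton_pow, Ideal.mem_span_singleton, map_mul] at hρ
  -- `ρ(s) ∉ (X)`
  have hsX : ¬ (X : D[X]) ∣ (mapRingHom σ) s := by
    intro hdvd
    apply hs
    show s ∈ p
    rw [hp, Ideal.mem_comap, Ideal.mem_span_singleton]
    exact hdvd
  have hdvd : (X : D[X]) ^ (m + 1) ∣ (mapRingHom σ) h :=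
    (Polynomial.prime_X.pow_dvd_of_dvd_mul_left (m + 1) hsX hρ)
  have hne : (mapRingHom σ) h ≠ 0 := by
    change h.map σ ≠ 0
    exact hmon.ne_zero
  have hle := Polynomial.natDegree_le_of_dvd hdvd hne
  rw [Polynomial.natDegree_pow, Polynomial.natDegree_X, mul_one] at hle
  change m + 1 ≤ (h.map σ).natDegree at hle
  omega

/-! ## The Hilbert function of `R_Q`, `R = S[X]/(h)` -/

variable [IsRegularLocalRing S]

/-- `S[X]` is a regular ring when `S` is a regular local ring (Serre, and Mathlib's polynomial extension). [cite: Matsumura1987, Thm. 19.5] -/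
theorem isRegularRing_polynomial : IsRegularRing S[X] := by
  haveI : IsRegularRing S := isRegularRing_of_isRegularLocalRing S
  infer_instance

/-- **The Hilbert function of a localised hypersurface.** Let `S` be regular local, `B = S[X]`, `h ∈ B`, `R = B/(h)`, `Q` a prime of
`R`, `p = Q ∩ B`. If `h ∈ p^m` and `h ∉ p^{(m+1)}`, then `H^{(0)}[R_Q] = hypersurfaceHFe (edim B_p) m` and `dim R_Q + 1 = dim B_p`.
[cite: CossartJannsenSaito2020, Thm. 2.3] [cite: Matsumura1987, Thm. 14.2, Thm. 19.3] -/
theorem hilbertFun_localization_atPrime_quotient (h : S[X]) {m : ℕ} (Q : Ideal (S[X] ⧸ Ideal.span {h})) [Q.IsPrime]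
    (p : Ideal S[X]) [p.IsPrime] (hp : p = Q.comap (Ideal.Quotient.mk (Ideal.span {h}))) (hm : h ∈ p ^ m)
    (hord : h ∉ ((maximalIdeal (Localization.AtPrime p)) ^ (m + 1)).comap (algebraMap S[X] (Localization.AtPrime p))) :
    hilbertFun (Localization.AtPrime Q) = hypersurfaceHFe ((maximalIdeal (Localization.AtPrime p)).spanFinrank) m ∧
      ringKrullDim (Localization.AtPrime Q) + 1 = ringKrullDim (Localization.AtPrime p) := by
  haveI : IsRegularRing S[X] := isRegularRing_polynomial
  haveI : IsRegularLocalRing (Localization.AtPrime p) := inferInstance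
  set g : Localization.AtPrime p := algebraMap S[X] (Localization.AtPrime p) h with hg
  -- `h B_p = (g)`
  have hmap : (Ideal.span {h}).map (algebraMap S[X] (Localization.AtPrime p)) = Ideal.span {g} := by
    rw [Ideal.map_span, Set.image_singleton]
  -- orders of `g`
  have hgm : g ∈ maximalIdeal (Localization.AtPrime p) ^ m := by
    rw [← Localization.AtPrime.map_eq_maximalIdeal, ← Ideal.map_pow]
    exact Ideal.mem_map_of_mem _ hm
  have hgm' : g ∉ maximalIdeal (Localization.AtPrime p) ^ (m + 1) := fun hc =>
    hord (by rw [Ideal.mem_comap]; exact hc)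
  have hg0 : g ≠ 0 := fun hc => hgm' (hc ▸ zero_mem _)
  have hgmax : g ∈ maximalIdeal (Localization.AtPrime p) := by
    have hhp : h ∈ p := by
      rw [hp, Ideal.mem_comap, Ideal.Quotient.eq_zero_iff_mem.mpr (Ideal.mem_span_singleton_self h)]
      exact zero_mem _
    rw [← Localization.AtPrime.map_eq_maximalIdeal]
    exact Ideal.mem_map_of_mem _ hhp
  haveI : IsLocalRing (Localization.AtPrime p ⧸ Ideal.span {g}) :=
    Literature.AlgebraicGeometry.Resolution.isLocalRing_quotient
      (Ideal.span_singleton_ne_top ((IsLocalRing.mem_maximalIdeal g).mp hgmax))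
  -- the equivalence `B_p/(g) ≅ R_Q`
  obtain ⟨e⟩ := exists_ringEquiv_localization_quotient (Ideal.span {h}) Q p hp
  rw [hmap] at e
  refine ⟨?_, ?_⟩
  · rw [← hilbertFun_eq_of_ringEquiv e]
    exact hilbertFun_quotient_span_singleton rfl hgm hgm'
  · rw [← ringKrullDim_eq_of_ringEquiv e]
    haveI := isDomain_of_isRegularLocalRing (Localization.AtPrime p)
    exact ringKrullDim_quotient_span_singleton_succ_eq_ringKrullDim_of_mem_nonZeroDivisors
      (mem_nonZeroDivisors_of_ne_zero hg0) hgmax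

/-- **Hypersurfaces in regular local rings are equidimensional**: for `R` regular local of dimension `e` and
`0 ≠ g ∈ 𝔪`, EVERY minimal prime `P'` of `R/(g)` has `dim (R/(g))/P' = e - 1` (its contraction `P ⊂ R` is a height-one
prime by Krull's Hauptidealsatz, and `ht P + dim R/P = dim R` in the catenary domain `R`). The tree's
`minimalPrimesCodim_quotient_span_singleton` records only the minimum `ψ(R/(g)) = e - 1`; same proof.
[cite: Matsumura1987, §5 (p. 31), Thm. 13.5, Thm. 17.4] -/
theorem ringKrullDim_quotient_eq_of_mem_minimalPrimes_quotient_span_singleton {R : Type u} [CommRing R]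
    [IsRegularLocalRing R] {e : ℕ} (he : ringKrullDim R = e) {g : R} (hg0 : g ≠ 0)
    {P' : Ideal (R ⧸ Ideal.span {g})} (hP' : P' ∈ minimalPrimes (R ⧸ Ideal.span {g})) :
    ringKrullDim ((R ⧸ Ideal.span {g}) ⧸ P') = (e - 1 : ℕ) := by
  haveI : IsDomain R := isDomain_of_isRegularLocalRing R
  -- `P = P' ∩ R` is a minimal prime over `(g)`, of height `1`
  set P : Ideal R := P'.comap (Ideal.Quotient.mk (Ideal.span {g})) with hP
  have hPmin : P ∈ (Ideal.span {g}).minimalPrimes := by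
    rw [Ideal.minimalPrimes_eq_comap]
    exact ⟨P', hP', rfl⟩
  haveI hPp : P.IsPrime := hPmin.1.1
  have hgP : g ∈ P := hPmin.1.2 (Ideal.mem_span_singleton_self g)
  have h1 : P.height = 1 := by
    refine le_antisymm
      (Ideal.height_le_one_of_isPrincipal_of_mem_minimalPrimes (Ideal.span {g}) P hPmin) ?_
    rw [Order.one_le_iff_ne_zero, Ne, Ideal.height_eq_zero_iff_eq_bot]
    intro hbot
    rw [hbot, Ideal.mem_bot] at hgP
    exact hg0 hgP
  -- `ht P + dim R/P = dim R`
  have hformula := height_add_ringKrullDim_quotient P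
  haveI : Nontrivial (R ⧸ P) := Ideal.Quotient.nontrivial_iff.mpr hPp.ne_top
  haveI : IsLocalRing (R ⧸ P) := .of_surjective' (Ideal.Quotient.mk P) Ideal.Quotient.mk_surjective
  obtain ⟨d', hd'⟩ := exists_nat_cast_eq_ringKrullDim (R := R ⧸ P)
  rw [h1, he, hd'] at hformula
  have hsum : 1 + d' = e := by exact_mod_cast hformula
  -- `(R/(g))/P' ≅ R/P`
  have hP'eq : P.map (Ideal.Quotient.mk (Ideal.span {g})) = P' :=
    Ideal.map_comap_of_surjective _ Ideal.Quotient.mk_surjective P'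
  have hle : Ideal.span {g} ≤ P := (Ideal.span_singleton_le_iff_mem _).mpr hgP
  let ε : (R ⧸ Ideal.span {g}) ⧸ P' ≃+* R ⧸ P :=
    (Ideal.quotEquivOfEq hP'eq.symm).trans (DoubleQuot.quotQuotEquivQuotOfLE hle)
  rw [ringKrullDim_eq_of_ringEquiv ε, hd', show e - 1 = d' by omega]

/-! ## The primes `(X, u_a, u_b)` and `(𝔪_S, X)` of `S[X]` as contractions of `(X)` -/

omit [IsRegularLocalRing S] in
/-- `f ∈ σ[X]⁻¹((X))` iff `σ(f(0)) = 0`. [folklore] -/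
theorem mem_comap_mapRingHom_span_X_iff {D : Type u} [CommRing D] (σ : S →+* D) (f : S[X]) :
    f ∈ (Ideal.span {(X : D[X])}).comap (mapRingHom σ) ↔ σ (f.coeff 0) = 0 := by
  rw [Ideal.mem_comap, Ideal.mem_span_singleton, Polynomial.coe_mapRingHom, Polynomial.X_dvd_iff,
    Polynomial.coeff_map]

omit [IsRegularLocalRing S] in
/-- **`(X, a', b') S[X] = ρ⁻¹((X))`** for the coefficient reduction `ρ : S[X] → (S/(a', b'))[X]`. [folklore] -/
theorem span_X_C_C_eq_comap (a' b' : S) :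
    Ideal.span ({X, C a', C b'} : Set S[X]) =
      (Ideal.span {(X : (S ⧸ Ideal.span ({a', b'} : Set S))[X])}).comap
        (mapRingHom (Ideal.Quotient.mk (Ideal.span ({a', b'} : Set S)))) := by
  apply le_antisymm
  · rw [Ideal.span_le]
    intro f hf
    rw [SetLike.mem_coe, mem_comap_mapRingHom_span_X_iff, Ideal.Quotient.eq_zero_iff_mem]
    rcases hf with rfl | rfl | h3
    · rw [Polynomial.coeff_X_zero]
      exact zero_mem _
    · rw [Polynomial.coeff_C_zero]
      exact Ideal.subset_span (Set.mem_insert _ _)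
    · rw [Set.mem_singleton_iff] at h3
      rw [h3, Polynomial.coeff_C_zero]
      exact Ideal.subset_span (Set.mem_insert_of_mem _ (Set.mem_singleton _))
  · intro f hf
    rw [mem_comap_mapRingHom_span_X_iff, Ideal.Quotient.eq_zero_iff_mem] at hf
    rw [← Polynomial.X_mul_divX_add f]
    refine Ideal.add_mem _ (Ideal.mul_mem_right _ _ (Ideal.subset_span (Set.mem_insert _ _))) ?_
    have hle : (Ideal.span ({a', b'} : Set S)).map (C : S →+* S[X]) ≤
        Ideal.span ({X, C a', C b'} : Set S[X]) := by
      rw [Ideal.map_span, Ideal.span_le]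
      rintro _ ⟨s, hs, rfl⟩
      rcases hs with rfl | h2
      · exact Ideal.subset_span (Set.mem_insert_of_mem _ (Set.mem_insert _ _))
      · rw [Set.mem_singleton_iff] at h2
        rw [h2]
        exact Ideal.subset_span (Set.mem_insert_of_mem _ (Set.mem_insert_of_mem _ (Set.mem_singleton _)))
    exact hle (Ideal.mem_map_of_mem _ hf)

omit [IsRegularLocalRing S] in
/-- `f ∈ κ[X]⁻¹((X))` (`κ` the residue field of the local ring `S`) iff `f(0) ∈ 𝔪_S`: the ideal `(𝔪_S, X)`.
[folklore] -/
theorem mem_comap_residue_span_X_iff [IsLocalRing S] (f : S[X]) :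
    f ∈ (Ideal.span {(X : (ResidueField S)[X])}).comap (mapRingHom (residue S)) ↔
      f.coeff 0 ∈ maximalIdeal S := by
  rw [mem_comap_mapRingHom_span_X_iff, IsLocalRing.residue_eq_zero_iff]

omit [IsRegularLocalRing S] in
/-- `(𝔪_S, X)` is a maximal ideal of `S[X]` (`S[X]/(𝔪_S, X) ≅ κ`). [folklore] -/
theorem isMaximal_comap_residue_span_X [IsLocalRing S] :
    ((Ideal.span {(X : (ResidueField S)[X])}).comap (mapRingHom (residue S))).IsMaximal := by
  haveI : (Ideal.span {(X : (ResidueField S)[X])}).IsMaximal :=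
    PrincipalIdealRing.isMaximal_of_irreducible Polynomial.irreducible_X
  exact Ideal.comap_isMaximal_of_surjective _
    (Polynomial.map_surjective (residue S) Ideal.Quotient.mk_surjective)

omit [IsRegularLocalRing S] in
/-- If `A/I` is local, a maximal ideal `𝔫 ⊇ I` of `A` is THE maximal ideal: `𝔫 = 𝔪_{A/I} ∩ A`. [folklore] -/
theorem eq_comap_maximalIdeal_of_isMaximal {A : Type u} [CommRing A] (I 𝔫 : Ideal A) [h𝔫 : 𝔫.IsMaximal]
    [IsLocalRing (A ⧸ I)] (hI : I ≤ 𝔫) : 𝔫 = (maximalIdeal (A ⧸ I)).comap (Ideal.Quotient.mk I) := by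
  have hcm : (𝔫.map (Ideal.Quotient.mk I)).comap (Ideal.Quotient.mk I) = 𝔫 := by
    rw [Ideal.comap_map_of_surjective _ Ideal.Quotient.mk_surjective, ← RingHom.ker_eq_comap_bot,
      Ideal.mk_ker, sup_eq_left.mpr hI]
  have hmax : (𝔫.map (Ideal.Quotient.mk I)).IsMaximal := by
    refine (Ideal.map_eq_top_or_isMaximal_of_surjective _ Ideal.Quotient.mk_surjective h𝔫).resolve_left ?_
    intro htop
    apply h𝔫.ne_top
    rw [← hcm, htop, Ideal.comap_top]
  rw [← IsLocalRing.eq_maximalIdeal hmax, hcm]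

end Summit.ResolutionOfSingularities.ResolutionOfSingularities.Cruxes.SigmaMaxModifications.IdeasL1C4

end
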